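import Summits.BirchSwinnertonDyer.BirchSwinnertonDyer.Theorems.SoloInformedHeightPencil

/-!
# SoloInformedRadicalMotivic — the two-slope radical is normalisation-free (1-motivic)

`SoloInformedHeightPencil` reduced excess rank `rank E(ℚ) > r_an = r ≥ 2` (granted BOTH slope
identities `(ZZ_r)_α`, `(ZZ_r)_β` and both Kato divisibilities) to the RADICAL CONDITION `(R_αβ)_p`
at every good ordinary `p`: a non-zero `x ∈ ℚ_p^r` with `Σ xᵢ log_ω(Pᵢ) = 0` and
`Σᵢ xᵢ ⟨Pᵢ,Pⱼ⟩_p = 0 (∀ j)` on the Gross–Zagier family — all `r × r` minors of the `r × (r+1)`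
matrix `[log_ω(Pᵢ) | ⟨Pᵢ,Pⱼ⟩_p]` vanish. The entries `⟨Pᵢ,Pⱼ⟩_p` of ANY `p`-adic height still contain
a transcendental NORMALISATION: by Mazur–Tate (biextensions; Arithmetic and Geometry I, 1983) and
Coleman–Gross (Adv. Stud. Pure Math. 17, 1989) every `p`-adic height on `E(ℚ)` has the shape

  `⟨P,Q⟩_D = b(P,Q) + τ(Q)·log_ω(P)`,

where `b(Pᵢ,Pⱼ) = ξⱼ(Log_p yᵢⱼ)` is a `p`-adic LOGARITHM COORDINATE of a FIXED rational point `yᵢⱼ`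
(independent of `p` and of the height) of the extension `Gⱼ` of `E` by `𝔾_m` classified by `Pⱼ`
— equivalently of `yᵢ = (yᵢⱼ)ⱼ ∈ 𝒢_P(ℚ) ⊗ ℚ`, `𝒢_P` = the extension of `E` by `𝔾_m^r` classified by
`P₁,…,P_r` (Bloch's semiabelian variety, Invent. Math. 58 (1980)), `yᵢ` the unique lift of `Pᵢ`
with trivial canonical local splitting at every finite prime — read in an ALGEBRAIC trivialisation
`ξⱼ` of `(Lie Gⱼ)^∨ ⊃ (Lie E)^∨`, and `τ : E(ℚ) → ℚ_p` is the normalisation character of the height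
(for the member attached to the algebraic differential `η = x dx/y`: `τ = ±` the `p`-adic
quasi-period integral `∫^Q η`, transcendental; for the unit-root = canonical member: that plus
`κ_p·log_ω`, `κ_p` the unit-root direction in `H¹_dR`). Changing the algebraic trivialisation changes
`(b, τ)` by `(b - φ⊗log_ω, τ + φ)` with `φ ∈ Hom(E(ℚ),ℚ)`.

This file proves the linear algebra which makes the normalisation DROP OUT of `(R_αβ)`:

* `soloInformedRadical_vecMul_shear`, `soloInformedRadical_shear_iff`: for ANY matrix `B`, column
  `v` and row `t`, the radical `{x | x·v = 0, x B = 0}` of the augmented row-matrix `[v | B]` equals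
  that of `[v | B + v tᵀ]`: a shear of the columns by multiples of the column `v` — exactly what a
  change of normalisation `τ`, of trivialisation `φ`, or of pencil member `s` does — is invisible.
* `soloInformedRadical_iff_not_linearIndependent`: the radical is non-zero iff the `r` ROWS
  `(vᵢ ; Bᵢⱼ)ⱼ ∈ K × K^r` are linearly dependent, i.e. the `r × (r+1)` matrix has rank `≤ r - 1`.
* `soloInformedRadical_det_eq_zero_family`: a radical vector kills `det (B + v tᵀ - s·v vᵀ)` for
  every `t, s` (the whole two-parameter family of heights is degenerate).
* `soloInformedRadical_pencil_iff` (HEIGHT-DATA FORM): for two distinct pencil members `D₁`,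
  `D₂ = D₁ - t·ℓ⊗ℓ` (`t ≠ 0`) and ANY decomposition `⟨P,Q⟩_{D₁} = b(P,Q) + τ(Q)·ℓ(P)` (`b`, `τ`
  arbitrary functions — nothing is constructed), on every family `P`:
  `Reg_{D₁}(P) = 0 ∧ Reg_{D₂}(P) = 0 ↔` the rows `(ℓ(Pᵢ) ; b(Pᵢ,Pⱼ))ⱼ` are linearly dependent.

Reading for the summit. With `b` the Mazur–Tate/Coleman–Gross logarithm coordinates, row `i` of
`[ℓ | b]` IS the vector `Log_{𝒢_P,p}(yᵢ) ∈ Lie 𝒢_P ⊗ ℚ_p ≅ ℚ_p^{r+1}` in the algebraic basis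
`(ω, ξ₁, …, ξ_r)`. Hence `(R_αβ)_p ⟺` the `p`-adic logarithms of the `r` fixed, `ℤ`-independent,
Zariski-dense rational points `y₁,…,y_r` of the `(r+1)`-dimensional commutative algebraic group
`𝒢_P` span `≤ r - 1` dimensions: a LEOPOLDT-TYPE DEFECT of `Y_P = ⟨yᵢ⟩ ⊂ 𝒢_P(ℚ)` at `p`. What stands
between `(ZZ_r)_{α,β}` and `rank E(ℚ) = r_an` is therefore ONE prime `p` at which `Y_P` has no such
defect — one instance of Roy's structural rank conjecture for `p`-adic logarithms of algebraic
points (the entries of `[ℓ | b]` are `ℚ̄`-linearly independent by the `p`-adic analytic subgroup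
theorem and the rigidity of Bloch's extension, so the structural rank is `r`; Waldschmidt, Afr.
Mat. 22 (2011) = arXiv 1012.4823, Thm. 2 and Remarks 2–3, whose Conj. 1 is the simple-abelian
case). Unconditionally Schneider's method gives `p`-adic rank `≥ ℓd/(ℓ + d₁ + 2d₂)` with
`G = 𝔾_a^{d₀} × 𝔾_m^{d₁} × G₂` a DIRECT-FACTOR decomposition (Waldschmidt, Durham 1986 = New
advances in transcendence theory (1988) ch. 24, Thm. 1.1, Thm. 4.1, Cor. 4.3; ultrametric: Ann. of Math. 117
(1983) §6a): for the NON-SPLIT `𝒢_P` this means `d₁ = 0`, `d₂ = r + 1`, bound `r(r+1)/(3r+2)`, and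
excluding `p`-adic rank `n = 1` at `r = 2` needs `m(d-n) > (d₁+2d₂)(n-t)`, i.e. `4 > 6` — it FAILS
with slack (the count `4 > 4`/`6 > 6`, "exact boundary", is the split-weight accounting `d₁ = r`,
`d₂ = 1`, valid for `𝔾_m^r × E` only); the torus shadow `𝔾_m^{r+1}` (`d₂ = 0`) is the six
exponentials theorem (`4 > 3`). So `(R_αβ)_p` lies strictly beyond Schneider's method already at
`r = 2`, the deficit being the weight `2d₂` of the quasi-periodic directions. Burungale–Skinner–Wan
(arXiv:2603.20886, 2026, §5, Conj. 5.2, Prop. 5.3, Rem. 5.5) treat the abelian case `[log_{ωᵢ}(xⱼ)]`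
of exactly this rank question via the `p`-adic analytic subgroup theorem (Fuchs–Pham 2015), which
controls LINEAR relations with algebraic coefficients only (Baker–Wüstholz, Logarithmic Forms and
Diophantine Geometry, Thm. 6.1, Thms. 6.5–6.7 for third-kind elliptic integrals); `(R_αβ)` at
`r ≥ 2` is a relation of degree `r` among such 1-periods. Nothing in this file asserts a conjecture
or constructs a height, a point or a group: `B`, `v`, `t`, `s`, `b`, `τ`, `D₁`, `D₂`, `ℓ` are
parameters, and the dictionary above is documentation of what they are in the application.
-/

noncomputable section

open scoped Classical

open Matrix Literature.NumberTheory.EllipticCurves WeierstrassCurve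

namespace Summit.BirchSwinnertonDyer.BirchSwinnertonDyer.Theorems

/-! ### Shear invariance of the augmented radical -/

section LinearAlgebra

variable {ι κ : Type*} [Fintype ι] {K : Type*} [Field K]

/-- `x (v tᵀ) = (x·v) t`. [folklore] -/
theorem soloInformedRadical_vecMul_vecMulVec (x v : ι → K) (t : κ → K) :
    x ᵥ* vecMulVec v t = (x ⬝ᵥ v) • t := by
  ext j
  simp only [Matrix.vecMul, dotProduct, vecMulVec_apply, Pi.smul_apply, smul_eq_mul,
    Finset.sum_mul]
  exact Finset.sum_congr rfl fun i _ => by ring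

/-- **Shear invariance.** On the hyperplane `x·v = 0` the row vector `x` does not see a shear of the
columns by multiples of `v`: `x (B + v tᵀ) = x B`. In the application `t` is the (transcendental)
normalisation character of a `p`-adic height, or a change of algebraic trivialisation, or a change
of pencil member. [folklore] -/
theorem soloInformedRadical_vecMul_shear (B : Matrix ι κ K) (v : ι → K) (t : κ → K) {x : ι → K}
    (hvx : x ⬝ᵥ v = 0) : x ᵥ* (B + vecMulVec v t) = x ᵥ* B := by
  rw [Matrix.vecMul_add, soloInformedRadical_vecMul_vecMulVec, hvx, zero_smul, add_zero]

/-- The augmented radical `{x | x·v = 0 ∧ x B = 0}` of `[v | B]` equals that of `[v | B + v tᵀ]`.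
[folklore] -/
theorem soloInformedRadical_shear_iff (B : Matrix ι κ K) (v : ι → K) (t : κ → K) (x : ι → K) :
    (x ⬝ᵥ v = 0 ∧ x ᵥ* (B + vecMulVec v t) = 0) ↔ (x ⬝ᵥ v = 0 ∧ x ᵥ* B = 0) := by
  constructor
  · rintro ⟨hv, hB⟩
    exact ⟨hv, by rwa [soloInformedRadical_vecMul_shear B v t hv] at hB⟩
  · rintro ⟨hv, hB⟩
    exact ⟨hv, by rw [soloInformedRadical_vecMul_shear B v t hv, hB]⟩

/-- Two-parameter version (square case): the radical of `[v | B + v tᵀ - s·v vᵀ]` is that of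
`[v | B]` for all `t, s` — all heights of all normalisations and all pencil members have the same
augmented radical. [folklore] -/
theorem soloInformedRadical_shear_pencil_iff (B : Matrix ι ι K) (v t : ι → K) (s : K) (x : ι → K) :
    (x ⬝ᵥ v = 0 ∧ x ᵥ* (B + vecMulVec v t - s • vecMulVec v v) = 0) ↔
      (x ⬝ᵥ v = 0 ∧ x ᵥ* B = 0) := by
  constructor
  · rintro ⟨hv, hB⟩
    refine ⟨hv, ?_⟩
    rwa [Matrix.vecMul_sub, Matrix.vecMul_smul, soloInformedRadical_vecMul_shear B v t hv,
      soloInformedRadical_vecMul_vecMulVec, hv, zero_smul, smul_zero, sub_zero] at hB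
  · rintro ⟨hv, hB⟩
    refine ⟨hv, ?_⟩
    rw [Matrix.vecMul_sub, Matrix.vecMul_smul, soloInformedRadical_vecMul_shear B v t hv,
      soloInformedRadical_vecMul_vecMulVec, hv, zero_smul, smul_zero, sub_zero, hB]

/-- A non-zero augmented radical vector makes EVERY member `B + v tᵀ - s·v vᵀ` of the two-parameter
family singular. [folklore] -/
theorem soloInformedRadical_det_eq_zero_family (B : Matrix ι ι K) (v : ι → K) {x : ι → K}
    (hx : x ≠ 0) (hvx : x ⬝ᵥ v = 0) (hBx : x ᵥ* B = 0) (t : ι → K) (s : K) :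
    (B + vecMulVec v t - s • vecMulVec v v).det = 0 :=
  Matrix.exists_vecMul_eq_zero_iff.mp
    ⟨x, hx, ((soloInformedRadical_shear_pencil_iff B v t s x).mpr ⟨hvx, hBx⟩).2⟩

/-- The sum `Σ xᵢ • (vᵢ, Bᵢ)` in `K × (κ → K)` is `(x·v, x B)`. [folklore] -/
theorem soloInformedRadical_sum_smul_row (B : Matrix ι κ K) (v x : ι → K) :
    (∑ i, x i • ((v i, B i) : K × (κ → K))) = (x ⬝ᵥ v, x ᵥ* B) := by
  refine Prod.ext ?_ ?_
  · simp only [Prod.fst_sum, Prod.smul_fst, smul_eq_mul, dotProduct]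
  · funext j
    simp only [Prod.snd_sum, Prod.smul_snd, Finset.sum_apply, Pi.smul_apply, smul_eq_mul,
      Matrix.vecMul, dotProduct]

/-- **Radical = rank defect.** The augmented radical of `[v | B]` is non-zero iff the ROWS
`(vᵢ ; Bᵢⱼ)ⱼ` are linearly dependent, i.e. the `r × (r+1)` matrix `[v | B]` has rank `≤ r - 1`. In
the application row `i` is the `p`-adic logarithm vector of the fixed rational point `yᵢ` of
Bloch's semiabelian variety `𝒢_P` in an algebraic basis of `(Lie 𝒢_P)^∨`. [folklore] -/
theorem soloInformedRadical_iff_not_linearIndependent (B : Matrix ι κ K) (v : ι → K) :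
    (∃ x : ι → K, x ≠ 0 ∧ x ⬝ᵥ v = 0 ∧ x ᵥ* B = 0) ↔
      ¬ LinearIndependent K (fun i => ((v i, B i) : K × (κ → K))) := by
  rw [Fintype.not_linearIndependent_iff]
  constructor
  · rintro ⟨x, hx, hv, hB⟩
    refine ⟨x, ?_, Function.ne_iff.mp hx⟩
    rw [soloInformedRadical_sum_smul_row, hv, hB]
    rfl
  · rintro ⟨x, hsum, i, hi⟩
    rw [soloInformedRadical_sum_smul_row, Prod.mk_eq_zero] at hsum
    exact ⟨x, Function.ne_iff.mpr ⟨i, hi⟩, hsum.1, hsum.2⟩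

/-- For a SYMMETRIC `B` the row radical `x B = 0` is the column radical `B x = 0` used in
`SoloInformedHeightPencil`. [folklore] -/
theorem soloInformedRadical_vecMul_eq_zero_iff_of_symm (B : Matrix ι ι K) (hB : Bᵀ = B)
    (x : ι → K) : x ᵥ* B = 0 ↔ B *ᵥ x = 0 := by
  rw [← Matrix.vecMul_transpose, hB]

end LinearAlgebra

/-! ### Height-data form: the radical of `(R_αβ)` in any decomposition `⟨P,Q⟩ = b(P,Q) + τ(Q)ℓ(P)` -/

section HeightData

variable {W : WeierstrassCurve ℚ} {p : ℕ} [Fact p.Prime]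
  {D₁ D₂ : WeierstrassCurve.PAdicHeightData W p} {ℓ : W.toAffine.Point →+ ℚ_[p]} {t : ℚ_[p]}
  {b : W.toAffine.Point → W.toAffine.Point → ℚ_[p]} {τ : W.toAffine.Point → ℚ_[p]}

/-- Gram matrix in a decomposition `⟨P,Q⟩_{D₁} = b(P,Q) + τ(Q)·ℓ(P)`: `B₁ = [b(Pᵢ,Pⱼ)] + v τᵀ`,
`vᵢ = ℓ(Pᵢ)`. (`b`, `τ` are arbitrary functions: in the application `b(Pᵢ,Pⱼ) = ξⱼ(Log_p yᵢⱼ)` are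
logarithm coordinates of fixed rational points of the `𝔾_m`-extensions `Gⱼ` and `τ` is the
normalisation character of the height — Mazur–Tate 1983, Coleman–Gross 1989.) [folklore] -/
theorem soloInformedRadical_pairingMatrix_eq (hb : ∀ P Q, D₁.pairing P Q = b P Q + τ Q * ℓ P)
    {ι : Type*} (P : ι → W.toAffine.Point) :
    D₁.pairingMatrix P =
      Matrix.of (fun i j => b (P i) (P j)) + vecMulVec (fun i => ℓ (P i)) (fun j => τ (P j)) := by
  ext i j
  simp [WeierstrassCurve.PAdicHeightData.pairingMatrix, vecMulVec_apply, hb (P i) (P j), mul_comm]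

/-- **The radical is normalisation-free.** The splitting-free radical of `SoloInformedHeightPencil`
(`B₁ x = 0`, `Σ xᵢ ℓ(Pᵢ) = 0`) coincides, for ANY decomposition `⟨P,Q⟩_{D₁} = b(P,Q) + τ(Q)·ℓ(P)`,
with the radical of the augmented matrix `[ℓ(Pᵢ) | b(Pᵢ,Pⱼ)]`: the normalisation `τ` drops out.
[folklore] -/
theorem soloInformedRadical_universal (hb : ∀ P Q, D₁.pairing P Q = b P Q + τ Q * ℓ P)
    {ι : Type*} [Fintype ι] (P : ι → W.toAffine.Point) (x : ι → ℚ_[p]) :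
    ((fun i => ℓ (P i)) ⬝ᵥ x = 0 ∧ D₁.pairingMatrix P *ᵥ x = 0) ↔
      (x ⬝ᵥ (fun i => ℓ (P i)) = 0 ∧ x ᵥ* Matrix.of (fun i j => b (P i) (P j)) = 0) := by
  rw [dotProduct_comm, ← soloInformedRadical_vecMul_eq_zero_iff_of_symm _ (D₁.pairingMatrix_transpose P),
    soloInformedRadical_pairingMatrix_eq hb, soloInformedRadical_shear_iff]

/-- **`(R_αβ)` as a rank defect of fixed points.** Two distinct pencil members `D₁`, `D₂ = D₁ - t·ℓ⊗ℓ`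
(`t ≠ 0`) BOTH have zero Gram determinant on the family `P` iff, in any decomposition
`⟨P,Q⟩_{D₁} = b(P,Q) + τ(Q)·ℓ(P)`, the rows `(ℓ(Pᵢ) ; b(Pᵢ,Pⱼ))ⱼ ∈ ℚ_p × ℚ_p^r` are linearly
dependent. In the application: `(R_αβ)_p ⟺` the `p`-adic logarithms of the `r` fixed rational
points `y₁,…,y_r` of Bloch's semiabelian variety `𝒢_P` (dimension `r+1`) span `≤ r-1` dimensions —
a Leopoldt-type defect at `p` (Waldschmidt, arXiv:1012.4823, Conj. 1 / Rem. 3; Burungale–Skinner–Wan,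
arXiv:2603.20886, Conj. 5.2). [folklore] -/
theorem soloInformedRadical_pencil_iff (h : ∀ P Q, D₂.pairing P Q = D₁.pairing P Q - t * ℓ P * ℓ Q)
    (ht : t ≠ 0) (hb : ∀ P Q, D₁.pairing P Q = b P Q + τ Q * ℓ P) {ι : Type*} [Fintype ι]
    (P : ι → W.toAffine.Point) :
    (padicRegulatorOf D₁ P = 0 ∧ padicRegulatorOf D₂ P = 0) ↔
      ¬ LinearIndependent ℚ_[p] (fun i => ((ℓ (P i), fun j => b (P i) (P j)) : ℚ_[p] × (ι → ℚ_[p]))) := by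
  rw [← soloInformedRadical_iff_not_linearIndependent]
  constructor
  · rintro ⟨h₁, h₂⟩
    obtain ⟨x, hx, hBx, hvx⟩ := soloInformedPencil_dichotomy h ht P h₁ h₂
    obtain ⟨hv', hB'⟩ := (soloInformedRadical_universal hb P x).mp ⟨hvx, hBx⟩
    exact ⟨x, hx, hv', hB'⟩
  · rintro ⟨x, hx, hv, hB⟩
    obtain ⟨hvx, hBx⟩ := (soloInformedRadical_universal hb P x).mpr ⟨hv, hB⟩
    exact soloInformedPencil_padicRegulatorOf_eq_zero_of_common_radical h P hx hBx hvx

/-- One direction without `t ≠ 0` and for every member: a dependence among the rows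
`(ℓ(Pᵢ) ; b(Pᵢ,Pⱼ))ⱼ` kills the Gram determinant of EVERY height datum of the shape
`b + τ'⊗ℓ - s·ℓ⊗ℓ` — all normalisations, all pencil members. [folklore] -/
theorem soloInformedRadical_padicRegulatorOf_eq_zero {D : WeierstrassCurve.PAdicHeightData W p}
    {τ' : W.toAffine.Point → ℚ_[p]} {s : ℚ_[p]}
    (hD : ∀ P Q, D.pairing P Q = b P Q + τ' Q * ℓ P - s * ℓ P * ℓ Q) {ι : Type*} [Fintype ι]
    (P : ι → W.toAffine.Point)
    (hdep : ¬ LinearIndependent ℚ_[p]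
      (fun i => ((ℓ (P i), fun j => b (P i) (P j)) : ℚ_[p] × (ι → ℚ_[p])))) :
    padicRegulatorOf D P = 0 := by
  obtain ⟨x, hx, hv, hB⟩ := (soloInformedRadical_iff_not_linearIndependent _ _).mpr hdep
  have hM : D.pairingMatrix P = Matrix.of (fun i j => b (P i) (P j)) +
      vecMulVec (fun i => ℓ (P i)) (fun j => τ' (P j)) -
        s • vecMulVec (fun i => ℓ (P i)) (fun i => ℓ (P i)) := by
    ext i j
    simp [WeierstrassCurve.PAdicHeightData.pairingMatrix, vecMulVec_apply, hD (P i) (P j), mul_comm,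
      mul_left_comm]
  unfold padicRegulatorOf
  rw [hM]
  exact soloInformedRadical_det_eq_zero_family _ _ hx hv hB _ _

end HeightData

end Summit.BirchSwinnertonDyer.BirchSwinnertonDyer.Theorems
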